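import Summits.QuantumFields.YangMills.Theorems.BalabanUVNodesN21ThresholdMixtureRStepLocality

/-!
# N21 (NE7c), strategy s3 «alternative currency», file 22b — FILE 22 §2∕§3 RESTATED AT PLAQUETTE LEVEL (LENS nearmiss g12 LOCATED-LOC): the (LOC) hypothesis
# the record statistics actually consume is «the PLAQUETTE VARIABLES `U(∂p)`, `p ⊂ □^∼`, of the (2.16) background are invariant», not the whole configuration

Seat `pub-ymgap-dag-n21-e` (R141 (C) fan-out, node N21 = NE7c `T4IndicatorShell.ShellWeightBound`, strategy s3), g8.  Lane: `--kind proof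
--supports stmt-QuantumFields-20292 --as helper` (K3⁗ `SpineGivenEndpointR13Sep`).  Count-neutral.  ERRATUM-BY-SUCCESSOR to file 22
(`…RStepLocality`, p516607): the lens seat `ym-lens-BalabanUVNodes-nearmiss` (g12, bus l.18411, `Sketch-nearmiss-g12.lean` §L sha16 54f6b1ba96079ca3) LOCATED that
file 22's (LOC) hypotheses `hloc`∕`hdep` — equality of the WHOLE (2.16) configuration `ukBox bg M₁ □^{≈4} k V` under fibre updates ∕ off a local bond set — are
ONE LEVEL TOO STRONG: by [Balaban1988Convergent] (2.2) the scale-0 member of `𝐁_k(□^{≈4})` is `Γ₀ = Ω₁(□^{≈4})ᶜ` and the (2.12) constraint at scale 0 pins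
`U_{k,□}(V)` to the datum on every `Γ₀`-bond, so the configuration reads `V` at EVERY level-`k` bond far from `□^{≈4}` (lens `ukBox_apply_of_corridor`,
negative edge `not_configLevel_hdep`): file 22's theorems are correct but their hypothesis is refutable exactly in the OFF situation they serve (the
vacuity species this seat flagged for b01's `hden`).  THE REPAIR (lens (L2)–(L4)): the statistic reads `U_{k,□}(V)` ONLY through the plaquette variables
`U(∂p)`, `p ⊂ □^∼` — so the hypothesis to display is PLAQUETTE-LEVEL invariance `hlocP`∕`hdepP`, which the lens DISCHARGES in tree for the interior-local
normalisation `normalise bg hreg` (r11 `B14Eq12InteriorLocality.ukBox_normalise_congr_on` + `plaqHol_congr`: plaquettes avoiding the far bonds depend on `V`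
only on the LOCAL read set `liftIter k (inputs (near (Bj M₁ □^{≈4} k)))`) — pending def-χ∕def-R's one-line answer whether the record's χ is read through
`normalise`.  This file restates file 22 §2∕§3 with `hloc ↦ hlocP`, `hdep ↦ hdepP`; every proof is file 22 §1's `fibreIndep_comp_of_local` at
`X := (plaquettes) → SU(N)` (as the lens notes).  File 22's §1 and §4 are unaffected.

HONEST FRAMING.  NE7c is NOT PRINTED and NOT PROVED.  [folklore] bookkeeping; `hlocP`∕`hdepP` are DISPLAYED (dischargeable per the lens's Sketch-g12 §L for the
normalised background; for raw `bgOfRecord` the answer is def-χ's∕def-R's); nothing of Bałaban's asserted; N21 NOT discharged; count-neutral; one finite 𝕋⁴ at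
fixed `ε`; NOT ℝ⁴ ∕ OS ∕ gap ∕ Clay.

CITATION HEADER (lean-in-tree rule 2026-08-18).  BY NAME: file 22 `fibreIndep_comp_of_local` ∕ `fibreIndep_prod_smallInd`; file 21 `fibreIndep_prod_fac_smallInd`; 13b
`chi218_record_eq_prod_smallInd`; 14b `aWeight_eq_prod_fac_smallInd`; `B14.Eq216Concrete.ukBox`; `B14.Eq218Concrete.chi218`; def-T `Node00.aWeight` ∕ `sect3DataOfRecord`;
`T4DressedR.FibreIndep`.  Credit: LENS nearmiss g12 LOCATED-LOC (the diagnosis and the shape of the repair).  Context only (SHAPE): [Balaban1988Convergent] (2.2),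
(2.12), (2.16)–(2.17) pp. 255–257.

WHAT IS PROVED ([folklore]).  §1 `fibreIndep_supStat_of_localPlaq` (generic); §2 ★ `fibreIndep_recordStat_of_localPlaq` · ★★ `fibreIndep_chi218_off_of_localPlaq` ·
★★ `fibreIndep_chi218_off_of_dependsOnBondsPlaq`; §3 `fibreIndep_tStepStat32_of_localPlaq` · ★ `fibreIndep_aWeight_of_localPlaq`.
-/

set_option autoImplicit false

noncomputable section

open MeasureTheory Set
open scoped BigOperators ENNReal

namespace Summit.QuantumFields.YangMills.Theorems.N21ThresholdMixtureRStepLocalityPlaq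

open Literature.MathematicalPhysics.QuantumFieldTheory.Balaban1983to89
open Literature.MathematicalPhysics.QuantumFieldTheory.Balaban1983to89.T4DressedR (FibreIndep)
open Literature.MathematicalPhysics.QuantumFieldTheory.Balaban1983to89.T4IndicatorShell
open Literature.MathematicalPhysics.QuantumFieldTheory.Balaban1983to89.T4LipschitzLedger
open Summit.QuantumFields.YangMills.Theorems.N21ThresholdMixtureRStepCommonBox (fibreIndep_prod_fac_smallInd)
open Summit.QuantumFields.YangMills.Theorems.N21ThresholdMixtureRStepLocality (fibreIndep_comp_of_local fibreIndep_prod_smallInd)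

/-! ## §1 Generic: a sup-statistic of plaquette variables is fibre-independent once the PLAQUETTE VARIABLES are -/

section Generic

variable {P : Params} {j : ℕ} {G : Type*} [GaugeGroup G] [MeasurableSpace G] [HaarData G]
variable [DecidableEq (PBond P j)]

omit [GaugeGroup G] [MeasurableSpace G] [HaarData G] in
/-- (LOC) AT THE RIGHT LEVEL: if every read plaquette variable `Φ V p` (`p : T`) is invariant under fibre updates, so is any statistic `g (p ↦ Φ V p)` of them —
file 22's `fibreIndep_comp_of_local` at `X := T → Y`. [folklore] -/
theorem fibreIndep_supStat_of_localPlaq {T Y : Type*} (Φ : GaugeField P j G → T → Y) (gs : (T → Y) → ℝ) (s : Finset (PBond P j))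
    (hlocP : ∀ (V : GaugeField P j G) (y : s → G) (p : T), Φ (Function.updateFinset V s y) p = Φ V p) :
    FibreIndep s (fun V => gs (Φ V)) :=
  fibreIndep_comp_of_local Φ gs s fun V y => funext fun p => hlocP V y p

end Generic

/-! ## §2 At the record's χ-slots (13b's letters), plaquette level -/

section AtRecord

open Literature.MathematicalPhysics.QuantumFieldTheory.Balaban1983to89.Node00
open T4Continuum B15DeterminingSets B14.Eq213DetSet B14.Eq216Concrete B14.Eq213MaximalDomains B15Eq112TorusCover B14DomainGeom
  B14.Eq218Concrete

variable (F : T4Family) (N : ℕ) [NeZero N]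

/-- ★ **The record's block-sup statistic of cube `□` is fibre-independent of `s` once the PLAQUETTE VARIABLES `U_{k,□}(V)(∂p)`, `p ⊂ □^∼`, of the (2.16)
background are invariant under `s`-updates** (`hlocP`; file 22's `fibreIndep_recordStat_of_local` asked invariance of the whole configuration — too strong,
lens g12). [cite: Balaban1988Convergent, (2.16)–(2.17) p.257 (bookkeeping)] -/
theorem fibreIndep_recordStat_of_localPlaq (ν : Stage7Numerics) (g : ℕ → ℝ) (K k : ℕ) [DecidableEq (PBond (F.P K) k)] (s : Finset (PBond (F.P K) k))
    (a : Pt (F.P K).d)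
    (hlocP : ∀ (V : GaugeField (F.P K) k (SU N)) (y : s → SU N) (p : ↥(plaqInside (cubeEnl (F.P K) (cubeSide (F.P K).L ν.M₂ (RkOfRecord (F.P K).L ν.r (g k)) k) a 1))),
      GaugeField.plaqHol (ukBox (bgOfRecord (avOfRecord F N K) {U | PlaqSmall (ν.εreg * (F.P K).eta k ^ 2) U}) ν.M₁ (cubeEnl (F.P K) (cubeSide (F.P K).L ν.M₂ (RkOfRecord (F.P K).L ν.r (g k)) k) a 4) k (Function.updateFinset V s y)) p.1
        = GaugeField.plaqHol (ukBox (bgOfRecord (avOfRecord F N K) {U | PlaqSmall (ν.εreg * (F.P K).eta k ^ 2) U}) ν.M₁ (cubeEnl (F.P K) (cubeSide (F.P K).L ν.M₂ (RkOfRecord (F.P K).L ν.r (g k)) k) a 4) k V) p.1) :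
    FibreIndep s fun V : GaugeField (F.P K) k (SU N) =>
      ⨆ p : ↥(plaqInside (cubeEnl (F.P K) (cubeSide (F.P K).L ν.M₂ (RkOfRecord (F.P K).L ν.r (g k)) k) a 1)), dist1 (GaugeField.plaqHol (ukBox (bgOfRecord (avOfRecord F N K) {U | PlaqSmall (ν.εreg * (F.P K).eta k ^ 2) U}) ν.M₁ (cubeEnl (F.P K) (cubeSide (F.P K).L ν.M₂ (RkOfRecord (F.P K).L ν.r (g k)) k) a 4) k V) p.1) :=
  fibreIndep_supStat_of_localPlaq (fun V (p : ↥(plaqInside (cubeEnl (F.P K) (cubeSide (F.P K).L ν.M₂ (RkOfRecord (F.P K).L ν.r (g k)) k) a 1))) => GaugeField.plaqHol (ukBox (bgOfRecord (avOfRecord F N K) {U | PlaqSmall (ν.εreg * (F.P K).eta k ^ 2) U}) ν.M₁ (cubeEnl (F.P K) (cubeSide (F.P K).L ν.M₂ (RkOfRecord (F.P K).L ν.r (g k)) k) a 4) k V) p.1)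
    (fun W => ⨆ p, dist1 (W p)) s hlocP

/-- ★★ **THE OFF PART OF THE SEQUENCE's FRONT FACTOR IS FIBRE-INDEPENDENT once the read plaquette variables of every OFF cube's background are
invariant under fibre updates** (file 22's `fibreIndep_chi218_off_of_local` with `hloc ↦ hlocP`). [cite: Balaban1988Convergent, (2.16)–(2.18) p.257] -/
theorem fibreIndep_chi218_off_of_localPlaq (ν : Stage7Numerics) (g : ℕ → ℝ) (K k : ℕ) [DecidableEq (PBond (F.P K) k)]
    (fib : Finset (PBond (F.P K) k)) {D : ℕ → Set (Set (Site (F.P K) 0))} (s : Seq D k) (On : Finset ↥(cubeIndices (F.P K) (cubeSide (F.P K).L ν.M₂ (RkOfRecord (F.P K).L ν.r (g k)) k)))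
    (hlocP : ∀ c ∈ cubesIn (fun a : ↥(cubeIndices (F.P K) (cubeSide (F.P K).L ν.M₂ (RkOfRecord (F.P K).L ν.r (g k)) k)) => cubeEnl (F.P K) (cubeSide (F.P K).L ν.M₂ (RkOfRecord (F.P K).L ν.r (g k)) k) a 0) (s.Ω k), c ∉ On →
      ∀ (V : GaugeField (F.P K) k (SU N)) (y : fib → SU N) (p : ↥(plaqInside (cubeEnl (F.P K) (cubeSide (F.P K).L ν.M₂ (RkOfRecord (F.P K).L ν.r (g k)) k) c 1))),
        GaugeField.plaqHol (ukBox (bgOfRecord (avOfRecord F N K) {U | PlaqSmall (ν.εreg * (F.P K).eta k ^ 2) U}) ν.M₁ (cubeEnl (F.P K) (cubeSide (F.P K).L ν.M₂ (RkOfRecord (F.P K).L ν.r (g k)) k) c 4) k (Function.updateFinset V fib y)) p.1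
          = GaugeField.plaqHol (ukBox (bgOfRecord (avOfRecord F N K) {U | PlaqSmall (ν.εreg * (F.P K).eta k ^ 2) U}) ν.M₁ (cubeEnl (F.P K) (cubeSide (F.P K).L ν.M₂ (RkOfRecord (F.P K).L ν.r (g k)) k) c 4) k V) p.1) :
    FibreIndep fib fun V : GaugeField (F.P K) k (SU N) =>
      ∏ c ∈ (cubesIn (fun a : ↥(cubeIndices (F.P K) (cubeSide (F.P K).L ν.M₂ (RkOfRecord (F.P K).L ν.r (g k)) k)) => cubeEnl (F.P K) (cubeSide (F.P K).L ν.M₂ (RkOfRecord (F.P K).L ν.r (g k)) k) a 0) (s.Ω k)).filter (fun c => c ∉ On),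
        smallInd (⨆ p : ↥(plaqInside (cubeEnl (F.P K) (cubeSide (F.P K).L ν.M₂ (RkOfRecord (F.P K).L ν.r (g k)) k) c 1)), dist1 (GaugeField.plaqHol (ukBox (bgOfRecord (avOfRecord F N K) {U | PlaqSmall (ν.εreg * (F.P K).eta k ^ 2) U}) ν.M₁ (cubeEnl (F.P K) (cubeSide (F.P K).L ν.M₂ (RkOfRecord (F.P K).L ν.r (g k)) k) c 4) k V) p.1))
          (epsOfRecord ν g k * (F.P K).eta k ^ 2) :=
  fibreIndep_prod_smallInd fib _
    (u := fun (c : ↥(cubeIndices (F.P K) (cubeSide (F.P K).L ν.M₂ (RkOfRecord (F.P K).L ν.r (g k)) k))) (V : GaugeField (F.P K) k (SU N)) =>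
      ⨆ p : ↥(plaqInside (cubeEnl (F.P K) (cubeSide (F.P K).L ν.M₂ (RkOfRecord (F.P K).L ν.r (g k)) k) c 1)), dist1 (GaugeField.plaqHol (ukBox (bgOfRecord (avOfRecord F N K) {U | PlaqSmall (ν.εreg * (F.P K).eta k ^ 2) U}) ν.M₁ (cubeEnl (F.P K) (cubeSide (F.P K).L ν.M₂ (RkOfRecord (F.P K).L ν.r (g k)) k) c 4) k V) p.1))
    (fun c hc => fibreIndep_recordStat_of_localPlaq F N ν g K k fib c.1 (hlocP c (Finset.mem_filter.1 hc).1 (Finset.mem_filter.1 hc).2)) _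

/-- ★★ **KT-28 FOR THE FRONT FACTOR IN THE TWO NAMED FACTS, PLAQUETTE LEVEL, OFF DEFINED BY DISJOINTNESS**: (LOC-P) the plaquette variables `U_{k,□_c}(V)(∂p)`,
`p ⊂ □_c^∼`, depend on `V` only through a finite bond set `B c` (for the interior-local normalisation this is r11's `ukBox_normalise_congr_on` + `plaqHol_congr` with
`B c :=` the local read set — lens Sketch-g12 (L3)); then for ANY fibre the product over the cubes of `Ω_k(s)` whose `B c` misses the fibre is fibre-independent
(file 22's `…_of_dependsOnBonds` with `hdep ↦ hdepP`). [cite: Balaban1988Convergent, (2.12), (2.16)–(2.17) pp.256–257; Balaban1989LargeFieldI, (0.3) p.176] -/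
theorem fibreIndep_chi218_off_of_dependsOnBondsPlaq (ν : Stage7Numerics) (g : ℕ → ℝ) (K k : ℕ) [DecidableEq (PBond (F.P K) k)]
    (fib : Finset (PBond (F.P K) k)) {D : ℕ → Set (Set (Site (F.P K) 0))} (s : Seq D k)
    (B : ↥(cubeIndices (F.P K) (cubeSide (F.P K).L ν.M₂ (RkOfRecord (F.P K).L ν.r (g k)) k)) → Finset (PBond (F.P K) k))
    (hdepP : ∀ (c : ↥(cubeIndices (F.P K) (cubeSide (F.P K).L ν.M₂ (RkOfRecord (F.P K).L ν.r (g k)) k))) (V W : GaugeField (F.P K) k (SU N)), (∀ b ∈ B c, V b = W b) →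
      ∀ p : ↥(plaqInside (cubeEnl (F.P K) (cubeSide (F.P K).L ν.M₂ (RkOfRecord (F.P K).L ν.r (g k)) k) c 1)),
        GaugeField.plaqHol (ukBox (bgOfRecord (avOfRecord F N K) {U | PlaqSmall (ν.εreg * (F.P K).eta k ^ 2) U}) ν.M₁ (cubeEnl (F.P K) (cubeSide (F.P K).L ν.M₂ (RkOfRecord (F.P K).L ν.r (g k)) k) c 4) k V) p.1 = GaugeField.plaqHol (ukBox (bgOfRecord (avOfRecord F N K) {U | PlaqSmall (ν.εreg * (F.P K).eta k ^ 2) U}) ν.M₁ (cubeEnl (F.P K) (cubeSide (F.P K).L ν.M₂ (RkOfRecord (F.P K).L ν.r (g k)) k) c 4) k W) p.1) :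
    FibreIndep fib fun V : GaugeField (F.P K) k (SU N) =>
      ∏ c ∈ (cubesIn (fun a : ↥(cubeIndices (F.P K) (cubeSide (F.P K).L ν.M₂ (RkOfRecord (F.P K).L ν.r (g k)) k)) => cubeEnl (F.P K) (cubeSide (F.P K).L ν.M₂ (RkOfRecord (F.P K).L ν.r (g k)) k) a 0) (s.Ω k)).filter (fun c => Disjoint (B c) fib),
        smallInd (⨆ p : ↥(plaqInside (cubeEnl (F.P K) (cubeSide (F.P K).L ν.M₂ (RkOfRecord (F.P K).L ν.r (g k)) k) c 1)), dist1 (GaugeField.plaqHol (ukBox (bgOfRecord (avOfRecord F N K) {U | PlaqSmall (ν.εreg * (F.P K).eta k ^ 2) U}) ν.M₁ (cubeEnl (F.P K) (cubeSide (F.P K).L ν.M₂ (RkOfRecord (F.P K).L ν.r (g k)) k) c 4) k V) p.1))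
          (epsOfRecord ν g k * (F.P K).eta k ^ 2) :=
  fibreIndep_prod_smallInd fib _
    (u := fun (c : ↥(cubeIndices (F.P K) (cubeSide (F.P K).L ν.M₂ (RkOfRecord (F.P K).L ν.r (g k)) k))) (V : GaugeField (F.P K) k (SU N)) =>
      ⨆ p : ↥(plaqInside (cubeEnl (F.P K) (cubeSide (F.P K).L ν.M₂ (RkOfRecord (F.P K).L ν.r (g k)) k) c 1)), dist1 (GaugeField.plaqHol (ukBox (bgOfRecord (avOfRecord F N K) {U | PlaqSmall (ν.εreg * (F.P K).eta k ^ 2) U}) ν.M₁ (cubeEnl (F.P K) (cubeSide (F.P K).L ν.M₂ (RkOfRecord (F.P K).L ν.r (g k)) k) c 4) k V) p.1))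
    (fun c hc => fibreIndep_recordStat_of_localPlaq F N ν g K k fib c.1 fun V y p =>
      hdepP c _ _ (fun _ hb => by
        simp only [Function.updateFinset, dif_neg (Finset.disjoint_left.1 (Finset.mem_filter.1 hc).2 hb)]) p) _

end AtRecord

/-! ## §3 At the 𝐓-step's (3.2) slots (14b's letters), plaquette level -/

section AtTStep

open Literature.MathematicalPhysics.QuantumFieldTheory.Balaban1983to89.Node00
open T4Continuum B14.Sect3Decomp
open Summit.QuantumFields.YangMills.Theorems.N21ThresholdMixtureTStepChiAtRecord (aWeight_eq_prod_fac_smallInd)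

variable (F : T4Family) (N : ℕ) [NeZero N] (ν : Stage7Numerics) (M : ℕ) (p : B12.RunParams) (g : ℕ → ℝ) (k : ℕ)

/-- **The (3.2) tested variable of cube `□′` is fibre-independent of `s` once the PLAQUETTE VARIABLES of the localized background `U_{k+1,□′}(·)` on `□′^∼` are
invariant under `s`-updates** (file 22's `fibreIndep_tStepStat32_of_local` with `hloc ↦ hlocP`). [cite: Balaban1988Convergent, (3.2) p.265, (2.16) p.257 (bookkeeping)] -/
theorem fibreIndep_tStepStat32_of_localPlaq [DecidableEq (PBond (F.P p.K) (k + 1))] (sq : SeqOfRecord F ν M g p.K k) (c : Iχ F ν p g k)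
    (s : Finset (PBond (F.P p.K) (k + 1)))
    (hlocP : ∀ (V' : GaugeField (F.P p.K) (k + 1) (SU N)) (y : s → SU N) (q : ↥((sect3DataOfRecord F N ν M p g k sq).plaqT c)),
      GaugeField.plaqHol ((sect3DataOfRecord F N ν M p g k sq).UkLoc c (Function.updateFinset V' s y)) q.1
        = GaugeField.plaqHol ((sect3DataOfRecord F N ν M p g k sq).UkLoc c V') q.1) :
    FibreIndep s fun V' : GaugeField (F.P p.K) (k + 1) (SU N) =>
      ⨆ q : ↥((sect3DataOfRecord F N ν M p g k sq).plaqT c), dist1 (GaugeField.plaqHol ((sect3DataOfRecord F N ν M p g k sq).UkLoc c V') q.1) :=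
  fibreIndep_supStat_of_localPlaq
    (fun V' (q : ↥((sect3DataOfRecord F N ν M p g k sq).plaqT c)) => GaugeField.plaqHol ((sect3DataOfRecord F N ν M p g k sq).UkLoc c V') q.1)
    (fun W => ⨆ q, dist1 (W q)) s hlocP

/-- ★ **def-T's (3.2) LABEL WEIGHT `aWeight` IS FIBRE-INDEPENDENT of any bond set under which the read plaquette variables of the localized backgrounds of the
cubes of its range are invariant** (file 22's `fibreIndep_aWeight_of_local` with `hloc ↦ hlocP`; off the range `aWeight = 0`). [cite: Balaban1988Convergent, (3.2) p.265] -/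
theorem fibreIndep_aWeight_of_localPlaq [DecidableEq (PBond (F.P p.K) (k + 1))] (hε : 0 < epsOfRecord ν g (k + 1) * (F.P p.K).eta (k + 1) ^ 2)
    (sq : SeqOfRecord F ν M g p.K k) (Pl : Finset (Iχ F ν p g k)) (s : Finset (PBond (F.P p.K) (k + 1)))
    (hlocP : ∀ c ∈ cubes32 F ν M p g k sq, ∀ (V' : GaugeField (F.P p.K) (k + 1) (SU N)) (y : s → SU N)
      (q : ↥((sect3DataOfRecord F N ν M p g k sq).plaqT c)),
      GaugeField.plaqHol ((sect3DataOfRecord F N ν M p g k sq).UkLoc c (Function.updateFinset V' s y)) q.1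
        = GaugeField.plaqHol ((sect3DataOfRecord F N ν M p g k sq).UkLoc c V') q.1) :
    FibreIndep s (aWeight F N ν M p g k sq Pl) := by
  by_cases hPl : Pl ⊆ cubes32 F ν M p g k sq
  · have h := fibreIndep_prod_fac_smallInd s (cubes32 F ν M p g k sq) (fun c => if c ∈ Pl then Pol.large else Pol.small)
      (u := fun c (V' : GaugeField (F.P p.K) (k + 1) (SU N)) =>
        ⨆ q : ↥((sect3DataOfRecord F N ν M p g k sq).plaqT c), dist1 (GaugeField.plaqHol ((sect3DataOfRecord F N ν M p g k sq).UkLoc c V') q.1))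
      (fun c hc => fibreIndep_tStepStat32_of_localPlaq F N ν M p g k sq c s (hlocP c hc))
      (fun _ => epsOfRecord ν g (k + 1) * (F.P p.K).eta (k + 1) ^ 2)
    intro V' y
    rw [aWeight_eq_prod_fac_smallInd F N ν M p g k hε sq hPl, aWeight_eq_prod_fac_smallInd F N ν M p g k hε sq hPl]
    exact h V' y
  · intro V' y
    unfold aWeight
    rw [if_neg hPl, if_neg hPl]

end AtTStep

end Summit.QuantumFields.YangMills.Theorems.N21ThresholdMixtureRStepLocalityPlaq

end
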